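import Mathlib
import Literature.Combinatorics.Additive.TripleProductProperty
import Literature.Barriers.MatrixMultiplication.YoungSubgroupBarrier
import Summits.MatrixMultiplication.MatrixMultiplication.Theses.SnSubsetDichotomy

/-!
# Crux GlobalBranch (stmt-MatrixMultiplication-8303) — ideator 1 (gen 2), round 1: first lemmas of three levers

All declarations are STATEMENTS (`def … : Prop`); nothing here is claimed proved.
* Card `young-host-squeeze`      : `PairTPP`, `YoungHosted`, `youngDoubleCoset`, `HostedPairBound`,
                                   `DoubleCosetCard`, `DoubleCosetSqueeze`, `TwoHostedSubthreshold`.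
* Card `bregman-entropy-window`  : `rowProb`, `colProb`, `rowEnt`, `colEnt`, `CucklerKahn2009`,
                                   `EntropyWindow`, `QuotientKLDeficit`.
* Card `flat-tail-truncation`    : `umvFlat`, `umvFlatSgn`, `FlatTripleCount`.
-/

set_option linter.dupNamespace false
open scoped BigOperators
open Finset

namespace Summit.MatrixMultiplication.MatrixMultiplication.Cruxes.GlobalBranch.Ideator1R1G2

open Literature.Combinatorics.Additive Literature.Barriers.MatrixMultiplication

noncomputable section

variable {n : ℕ}

/-! ## Card A — young-host-squeeze -/

/-- The pairwise part of the TPP for `(S,T)`: `s s'⁻¹ t t'⁻¹ = 1 ⇒ s = s', t = t'`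
(equivalently `(s,t) ↦ s⁻¹ t` is injective on `S × T`). -/
def PairTPP (S T : Finset (Equiv.Perm (Fin n))) : Prop :=
  ∀ s ∈ S, ∀ s' ∈ S, ∀ t ∈ T, ∀ t' ∈ T, s * s'⁻¹ * t * t'⁻¹ = 1 → s = s' ∧ t = t'

/-- `S` is hosted by the Young coset `a · Y_f · b`. -/
def YoungHosted (f : Fin n → ℕ) (a b : Equiv.Perm (Fin n)) (S : Finset (Equiv.Perm (Fin n))) :
    Prop :=
  ∀ s ∈ S, a⁻¹ * s * b⁻¹ ∈ youngSubgroup f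

/-- The double coset `Y_f · x · Y_g` as a finset. -/
def youngDoubleCoset (f g : Fin n → ℕ) (x : Equiv.Perm (Fin n)) : Finset (Equiv.Perm (Fin n)) :=
  Finset.univ.filter (fun σ => ∃ y : Equiv.Perm (Fin n), y ∈ youngSubgroup f ∧
    ∃ y' : Equiv.Perm (Fin n), y' ∈ youngSubgroup g ∧ σ = y * x * y')

/-- FIRST LEMMA of card A (elementary): two Young-hosted sets with the pairwise TPP satisfy
`|S||T| = |S⁻¹T| ≤ |Y_f (a⁻¹a') Y_g|` (because `S⁻¹T ⊆ b⁻¹ Y_f a⁻¹ a' Y_g b'`). -/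
def HostedPairBound : Prop :=
  ∀ (n : ℕ) (f g : Fin n → ℕ) (a b a' b' : Equiv.Perm (Fin n)) (S T : Finset (Equiv.Perm (Fin n))),
    PairTPP S T → YoungHosted f a b S → YoungHosted g a' b' T →
      S.card * T.card ≤ (youngDoubleCoset f g (a⁻¹ * a')).card

/-- The double-coset count `|Y_f x Y_g| · |Y_f ∩ x Y_g x⁻¹| = |Y_f| · |Y_g|`, with the
intersection identified as the Young subgroup of the MEET labelling `p ↦ (f p, g (x⁻¹ p))`. -/
def DoubleCosetCard : Prop :=
  ∀ (n : ℕ) (f g : Fin n → ℕ) (x : Equiv.Perm (Fin n)),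
    (youngDoubleCoset f g x).card * Nat.card (youngSubgroup (fun p => (f p, g (x⁻¹ p)))) =
      Nat.card (youngSubgroup f) * Nat.card (youngSubgroup g)

/-- THE SQUEEZE (Stirling on the meet cells): if every block of `f` and of `g` has size in
`[n^{1/2-ε}, n^{1/2+ε}]` with `ε < 1/4`, then every double coset `Y_f x Y_g` is exponentially
smaller than `n!`: `|Y_f x Y_g| ≤ n! · exp(-c · n^{1/2-2ε})` for `n ≥ n₀(ε)`. -/
def DoubleCosetSqueeze : Prop :=
  ∀ ε : ℝ, 0 < ε → ε < 1 / 4 → ∃ c : ℝ, 0 < c ∧ ∃ n₀ : ℕ, ∀ n ≥ n₀, ∀ (f g : Fin n → ℕ),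
    (∀ i ∈ Set.range f, (n : ℝ) ^ (1 / 2 - ε) ≤ ((Finset.univ.filter (fun p => f p = i)).card : ℝ) ∧
        ((Finset.univ.filter (fun p => f p = i)).card : ℝ) ≤ (n : ℝ) ^ (1 / 2 + ε)) →
    (∀ j ∈ Set.range g, (n : ℝ) ^ (1 / 2 - ε) ≤ ((Finset.univ.filter (fun p => g p = j)).card : ℝ) ∧
        ((Finset.univ.filter (fun p => g p = j)).card : ℝ) ≤ (n : ℝ) ^ (1 / 2 + ε)) →
    ∀ x : Equiv.Perm (Fin n),
      ((youngDoubleCoset f g x).card : ℝ) ≤ (n.factorial : ℝ) * Real.exp (-(c * (n : ℝ) ^ (1 / 2 - 2 * ε)))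

/-- What the squeeze buys for the crux: a TPP triple two of whose sets are hosted by fine Young
cosets is sub-threshold with margin `exp(-(c/2) n^{1/2-2ε})` — in particular the bump-free hexagon
/ stretched-triangle families of the Disproof and all their sub-codes and mixed conjugates. -/
def TwoHostedSubthreshold : Prop :=
  ∀ ε : ℝ, 0 < ε → ε < 1 / 4 → ∃ c : ℝ, 0 < c ∧ ∃ n₀ : ℕ, ∀ n ≥ n₀,
    ∀ (f g : Fin n → ℕ) (a b a' b' : Equiv.Perm (Fin n)) (S T U : Finset (Equiv.Perm (Fin n))),
    (∀ i ∈ Set.range f, (n : ℝ) ^ (1 / 2 - ε) ≤ ((Finset.univ.filter (fun p => f p = i)).card : ℝ) ∧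
        ((Finset.univ.filter (fun p => f p = i)).card : ℝ) ≤ (n : ℝ) ^ (1 / 2 + ε)) →
    (∀ j ∈ Set.range g, (n : ℝ) ^ (1 / 2 - ε) ≤ ((Finset.univ.filter (fun p => g p = j)).card : ℝ) ∧
        ((Finset.univ.filter (fun p => g p = j)).card : ℝ) ≤ (n : ℝ) ^ (1 / 2 + ε)) →
    TripleProductProperty S T U → YoungHosted f a b S → YoungHosted g a' b' T →
      ((S.card * T.card * U.card : ℕ) : ℝ) ≤
        (n.factorial : ℝ) ^ ((3 : ℝ) / 2) * Real.exp (-(c / 2 * (n : ℝ) ^ (1 / 2 - 2 * ε)))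

/-! ## Card B — bregman-entropy-window -/

/-- Row marginal `P_{σ∈X}(σ i = j)`. -/
def rowProb (X : Finset (Equiv.Perm (Fin n))) (i j : Fin n) : ℝ :=
  ((X.filter (fun σ => σ i = j)).card : ℝ) / (X.card : ℝ)

/-- Column marginal `P_{σ∈X}(σ⁻¹ j = i)` (= `rowProb X i j`; kept for readability). -/
def colProb (X : Finset (Equiv.Perm (Fin n))) (j i : Fin n) : ℝ := rowProb X i j

/-- Shannon entropy (nats) of row `i`. -/
def rowEnt (X : Finset (Equiv.Perm (Fin n))) (i : Fin n) : ℝ := ∑ j, Real.negMulLog (rowProb X i j)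

/-- Shannon entropy (nats) of column `j`. -/
def colEnt (X : Finset (Equiv.Perm (Fin n))) (j : Fin n) : ℝ := ∑ i, Real.negMulLog (colProb X j i)

/-- Cuckler–Kahn 2009 (Combinatorica 29, "Entropy bounds for perfect matchings and Hamiltonian
cycles", main theorem specialised to `K_{n,n}` and to the UNIFORM measure on `X`): the entropy
`log |X|` of a set of permutations with spread marginals is at most
`½ (Σ_i H(row_i) + Σ_j H(col_j)) − n + o(n)` — Brégman's "−1 nat per vertex".  UNPROVED
literature fact (to be vendored); the technical spread condition is rendered as `max marginal ≤ η`. -/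
def CucklerKahn2009 : Prop :=
  ∀ δ : ℝ, 0 < δ → ∃ η : ℝ, 0 < η ∧ ∃ n₀ : ℕ, ∀ n ≥ n₀, ∀ X : Finset (Equiv.Perm (Fin n)),
    X.Nonempty → (∀ i j, rowProb X i j ≤ η) →
      Real.log (X.card : ℝ) ≤ (1 / 2) * (∑ i, rowEnt X i + ∑ j, colEnt X j) - n + δ * n

/-- ENTROPY WINDOW (card B, consequence 1): a bump-free set within `e^{-c√n}` of `√(n!)` has
average marginal entropy at least `½ log n + ½ − δ` — the set-theoretic form of the Young
`e^{-n/2}` deficit (Young blocks `b ≤ √n` have marginal entropy `log b ≤ ½ log n`, short by `½`). -/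
def EntropyWindow : Prop :=
  ∀ δ : ℝ, 0 < δ → ∀ c : ℝ, 0 < c → ∃ η : ℝ, 0 < η ∧ ∃ n₀ : ℕ, ∀ n ≥ n₀,
    ∀ X : Finset (Equiv.Perm (Fin n)), (∀ i j, rowProb X i j ≤ η) →
      Real.sqrt (n.factorial : ℝ) * Real.exp (-(c * Real.sqrt n)) ≤ (X.card : ℝ) →
        (2 * n : ℝ) * (Real.log n / 2 + 1 / 2 - δ) ≤ ∑ i, rowEnt X i + ∑ j, colEnt X j

/-- QUOTIENT KL DEFICIT (card B, consequence 2 = the 3-wise use): for a TPP triple, the volume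
deficit dominates a quarter of the total level-1 Kullback–Leibler non-uniformity of the three
quotient sets `S⁻¹T`, `T⁻¹U`, `U⁻¹S` (their marginal matrices are `D_T D_Sᵀ` etc.), up to `o(n)`:
`(3/2) log n! − log(|S||T||U|) ≥ ¼ Σ_{pairs} Σ_{v} (log n − H_v) − δ n`. -/
def QuotientKLDeficit : Prop :=
  ∀ δ : ℝ, 0 < δ → ∃ η : ℝ, 0 < η ∧ ∃ n₀ : ℕ, ∀ n ≥ n₀, ∀ S T U : Finset (Equiv.Perm (Fin n)),
    TripleProductProperty S T U → S.Nonempty → T.Nonempty → U.Nonempty →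
    (∀ X : Finset (Equiv.Perm (Fin n)), (X = S ∨ X = T ∨ X = U) → ∀ i j, rowProb X i j ≤ η) →
      (1 / 4) * (∑ i, (Real.log n - rowEnt (Finset.image₂ (fun s t => s⁻¹ * t) S T) i) +
                 ∑ j, (Real.log n - colEnt (Finset.image₂ (fun s t => s⁻¹ * t) S T) j) +
                 ∑ i, (Real.log n - rowEnt (Finset.image₂ (fun t u => t⁻¹ * u) T U) i) +
                 ∑ j, (Real.log n - colEnt (Finset.image₂ (fun t u => t⁻¹ * u) T U) j) +
                 ∑ i, (Real.log n - rowEnt (Finset.image₂ (fun u s => u⁻¹ * s) U S) i) +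
                 ∑ j, (Real.log n - colEnt (Finset.image₂ (fun u s => u⁻¹ * s) U S) j)) - δ * n ≤
        (3 / 2) * Real.log (n.factorial : ℝ) - Real.log ((S.card * T.card * U.card : ℕ) : ℝ)

/-! ## Card C — flat-tail-truncation -/

/-- Level-`ℓ` L²-flatness of the umvirate densities of `X`:
`Σ_{I,L injective} (μ_X(U_{I→L}) − 1/n^{(ℓ)})²` (= `Σ_{λ ≠ triv, level ≤ ℓ} K_λ ‖σ_λ‖²_HS` by
Parseval for the permutation character on injective `ℓ`-tuples). -/
def umvFlat (ℓ : ℕ) (X : Finset (Equiv.Perm (Fin n))) : ℝ :=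
  ∑ I : Fin ℓ ↪ Fin n, ∑ L : Fin ℓ ↪ Fin n,
    (((X.filter (fun σ => ∀ k, σ (I k) = L k)).card : ℝ) / (X.card : ℝ) -
      1 / (n.descFactorial ℓ : ℝ)) ^ 2

/-- The sign-twisted companion (controls the irreps `λ ⊗ sgn` of co-level `≤ ℓ`). -/
def umvFlatSgn (ℓ : ℕ) (X : Finset (Equiv.Perm (Fin n))) : ℝ :=
  ∑ I : Fin ℓ ↪ Fin n, ∑ L : Fin ℓ ↪ Fin n,
    ((∑ σ ∈ X.filter (fun σ => ∀ k, σ (I k) = L k), ((Equiv.Perm.sign σ : ℤ) : ℝ)) / (X.card : ℝ) -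
      (∑ σ ∈ X, ((Equiv.Perm.sign σ : ℤ) : ℝ)) / (X.card : ℝ) / (n.descFactorial ℓ : ℝ)) ^ 2

/-- FIRST LEMMA of card C (two-ended level truncation of the BCGPU identity
`n!·V = V² + Σ_{λ≠1} d_λ Tr(Ŝ*T̂ T̂*Û Û*Ŝ)`): if the three sets are L²-flat at every level
`ℓ ≤ L` at the scale `(n^{(ℓ)})^{-2/3}` (also sign-twisted, and sign-balanced), the low irreps
contribute at most `V²/2` and the tail saves `√(min d_λ) ≥ e^{-C L} √(n choose (L+1))`:
`V ≤ 2 n! + 2 (n!)^{3/2} e^{C L} / √(n choose (L+1))`.  With `L ≍ √n / log n` this is sub-threshold. -/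
def FlatTripleCount : Prop :=
  ∃ C : ℝ, 0 < C ∧ ∀ (n L : ℕ), 1 ≤ L → 2 * (L + 1) ≤ n →
    ∀ S T U : Finset (Equiv.Perm (Fin n)), TripleProductProperty S T U →
    (∀ X : Finset (Equiv.Perm (Fin n)), (X = S ∨ X = T ∨ X = U) →
      |(∑ σ ∈ X, ((Equiv.Perm.sign σ : ℤ) : ℝ))| / (X.card : ℝ) ≤ Real.exp (-(C * L)) ∧
      ∀ ℓ : ℕ, 1 ≤ ℓ → ℓ ≤ L →
        umvFlat ℓ X ≤ Real.exp (-(C * ℓ)) * ((n.descFactorial ℓ : ℝ) ^ ((2 : ℝ) / 3))⁻¹ ∧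
        umvFlatSgn ℓ X ≤ Real.exp (-(C * ℓ)) * ((n.descFactorial ℓ : ℝ) ^ ((2 : ℝ) / 3))⁻¹) →
      ((S.card * T.card * U.card : ℕ) : ℝ) ≤
        2 * (n.factorial : ℝ) +
          2 * (n.factorial : ℝ) ^ ((3 : ℝ) / 2) * Real.exp (C * L) / Real.sqrt (n.choose (L + 1) : ℝ)

/-- How the three levers feed the crux (bookkeeping only, to fix the shape of a future line):
two-hosted configurations (A) and linearly KL-biased quotient configurations (B) are
sub-threshold outright; flat configurations (C) are sub-threshold; what remains for
`GlobalBranch` is the class of bump-free triples with (i) at most one fine-Young-hosted set,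
(ii) `o(n)`-flat quotient marginals, (iii) a coherent low-level Fourier coefficient. -/
def ResidualClassToGlobalBranch : Prop :=
  TwoHostedSubthreshold → QuotientKLDeficit → FlatTripleCount →
    Summit.MatrixMultiplication.MatrixMultiplication.Theses.SnSubsetDichotomy.GlobalBranch

end

end Summit.MatrixMultiplication.MatrixMultiplication.Cruxes.GlobalBranch.Ideator1R1G2
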